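import Mathlib
import Summits.Parity.BatemanHorn.Theorems.SystemLSDRealSegment.Negative.OmegaWide

/-!
# Crux-triage r1 (triager k = 1) for `SelbergDelangeRigidity.LSDRealSegment` (stmt-Parity-9770):
# the stub `UncappedShortIntervalBound` of card `shared-kernel-uncapped-transfer` is FALSE as typed

Card `Ideas/shared-kernel-uncapped-transfer.md` (ideator 1) types, in `Cruxes/LSDRealSegment/Ideator1Sketch.lean`,
the "one new technical stub an Ω-line needs", a Nair–Tenenbaum-type short-interval upper bound for the
UN-capped tilt `y^{Ω_f(n)}`:

  `UncappedShortIntervalBound : ∀ k f, IsBatemanHornSystem f → ∀ y ∈ [1,2), ∀ ε > 0, ∃ C, ∀ᶠ x, ∀ h,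
     x^ε ≤ h → h ≤ x → Σ_{x < n ≤ x+h} y^{Ω_f(n)} ≤ C h (log x)^{k(y-1)}`.

It is false for the Bateman–Horn system `f = ![X]` at every `y > 1` (here `y = 19/10`, `ε = 1/2`): along
`x = 4^j - 1` the window `(x, x + ⌈√x⌉]` contains `n = 4^j`, whose single weight `y^{Ω(4^j)} = y^{2j} = x^{log₂ y}`
beats `C ⌈√x⌉ (log x)^{9/10} ≤ 6|C| j 2^j` because `(19/10)² = 3.61 > 2`.  (The same witness kills every
`ε < log₂ y`; the un-capped weight is outside Shiu's / Nair–Tenenbaum's class `M(A,B,ε)` — `y^{Ω(2^ν)} = (2^ν)^{log₂ y}`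
— and no peeling of finitely many small primes inside a SHORT window can repair it: one term carries the window.)

The definitions `OmegaF`, `UncappedShortIntervalBound` below are copied VERBATIM from `Ideator1Sketch.lean`
(namespace changed only), so `not_uncappedShortIntervalBound` refutes exactly the typed stub.
-/

open Filter Finset Polynomial
open scoped BigOperators ArithmeticFunction.omega ArithmeticFunction.Omega

namespace Summit.Parity.BatemanHorn.Cruxes.LSDRealSegment.TriageR1K1

open Literature.NumberTheory.Sieve
open Summit.Parity.BatemanHorn.Theorems.SystemLSDRealSegment.Negative (isBatemanHornSystem_X)

noncomputable section

variable {k : ℕ}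

/-- `Ω_f(n) = Σᵢ Ω(fᵢ(n))` — verbatim from `Ideator1Sketch.lean`. -/
def OmegaF (f : Fin k → ℤ[X]) (n : ℕ) : ℕ := ∑ i, Ω (((f i).eval (n : ℤ)).toNat)

/-- The stub (U) of card `shared-kernel-uncapped-transfer` — verbatim from `Ideator1Sketch.lean`. -/
def UncappedShortIntervalBound : Prop :=
  ∀ (k : ℕ) (f : Fin k → ℤ[X]), Literature.NumberTheory.Sieve.IsBatemanHornSystem f →
    ∀ y : ℝ, 1 ≤ y → y < 2 → ∀ ε : ℝ, 0 < ε → ∃ C : ℝ, ∀ᶠ x : ℕ in atTop, ∀ h : ℕ,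
      (x : ℝ) ^ ε ≤ h → h ≤ x →
        ∑ n ∈ Ioc x (x + h), y ^ OmegaF f n ≤ C * h * (Real.log x) ^ ((k : ℝ) * (y - 1))

/-- `Ω_{![X]}(n) = Ω(n)`. -/
theorem omegaF_X (n : ℕ) : OmegaF ![X] n = Ω n := by
  simp [OmegaF]

/-- `Ω(4^j) = 2j` for the family `![X]`. -/
theorem omegaF_X_four_pow (j : ℕ) : OmegaF ![X] (2 ^ (2 * j)) = 2 * j := by
  rw [omegaF_X]
  exact ArithmeticFunction.cardFactors_apply_prime_pow Nat.prime_two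

/-- Exponential beats linear: eventually `6 |C| j 2^j < (19/10)^{2j}`. -/
theorem eventually_lin_exp_lt (C : ℝ) :
    ∀ᶠ j : ℕ in atTop, 6 * |C| * j * (2 : ℝ) ^ j < (19 / 10 : ℝ) ^ (2 * j) := by
  have hr : (1 : ℝ) < 361 / 200 := by norm_num
  have h0 : Tendsto (fun j : ℕ => (j : ℝ) ^ 1 / (361 / 200 : ℝ) ^ j) atTop (nhds 0) :=
    tendsto_pow_const_div_const_pow_of_one_lt 1 hr
  have hpos : (0 : ℝ) < 1 / (6 * |C| + 1) := by positivity
  have hev := h0.eventually (gt_mem_nhds hpos)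
  filter_upwards [hev] with j hj
  simp only [pow_one] at hj
  have hq : (0 : ℝ) < (361 / 200 : ℝ) ^ j := by positivity
  rw [div_lt_iff₀ hq] at hj
  -- hj : j < 1 / (6|C|+1) * (361/200)^j
  have h1 : 6 * |C| * (j : ℝ) ≤ (6 * |C|) * (1 / (6 * |C| + 1) * (361 / 200 : ℝ) ^ j) := by
    have : (0 : ℝ) ≤ 6 * |C| := by positivity
    nlinarith
  have h2 : (6 * |C|) * (1 / (6 * |C| + 1) * (361 / 200 : ℝ) ^ j) < (361 / 200 : ℝ) ^ j := by
    have hfrac : 6 * |C| * (1 / (6 * |C| + 1)) < 1 := by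
      rw [mul_one_div, div_lt_one (by positivity)]
      linarith
    calc (6 * |C|) * (1 / (6 * |C| + 1) * (361 / 200 : ℝ) ^ j)
        = (6 * |C| * (1 / (6 * |C| + 1))) * (361 / 200 : ℝ) ^ j := by ring
      _ < 1 * (361 / 200 : ℝ) ^ j := by gcongr
      _ = _ := one_mul _
  have h3 : 6 * |C| * (j : ℝ) < (361 / 200 : ℝ) ^ j := lt_of_le_of_lt h1 h2
  have h2j : (0 : ℝ) < (2 : ℝ) ^ j := by positivity
  calc 6 * |C| * (j : ℝ) * (2 : ℝ) ^ j < (361 / 200 : ℝ) ^ j * (2 : ℝ) ^ j := by gcongr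
    _ = ((361 / 200 : ℝ) * 2) ^ j := (mul_pow _ _ _).symm
    _ = ((19 / 10 : ℝ) ^ 2) ^ j := by norm_num
    _ = (19 / 10 : ℝ) ^ (2 * j) := (pow_mul _ _ _).symm

/-- **The stub is false.** Witness `k = 1`, `f = ![X]`, `y = 19/10`, `ε = 1/2`, `x = 4^j - 1`, `h = ⌈x^{1/2}⌉`. -/
theorem not_uncappedShortIntervalBound : ¬ UncappedShortIntervalBound := by
  intro H
  obtain ⟨C, hC⟩ := H 1 ![X] isBatemanHornSystem_X (19 / 10) (by norm_num) (by norm_num) (1 / 2) (by norm_num)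
  rw [Filter.eventually_atTop] at hC
  obtain ⟨N, hN⟩ := hC
  have hgrow : Tendsto (fun j : ℕ => 2 ^ (2 * j)) atTop atTop := by
    refine tendsto_pow_atTop_atTop_of_one_lt one_lt_two |>.comp ?_
    exact tendsto_id.const_mul_atTop' two_pos
  obtain ⟨j, hjC, hjN, hj1⟩ := ((eventually_lin_exp_lt C).and
    ((hgrow.eventually_ge_atTop (N + 1)).and (eventually_ge_atTop 1))).exists
  have hjN' : N + 1 ≤ 2 ^ (2 * j) := by simpa [Function.comp_apply] using hjN
  -- the point `x = 4^j - 1` and the window length `h = ⌈√x⌉`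
  set x : ℕ := 2 ^ (2 * j) - 1 with hx
  have hpow1 : 1 ≤ 2 ^ (2 * j) := Nat.one_le_two_pow
  have hxN : N ≤ x := by rw [hx]; omega
  have hx1 : 1 ≤ x := by
    have : 2 ≤ 2 ^ (2 * j) := by
      calc 2 = 2 ^ 1 := (pow_one 2).symm
        _ ≤ 2 ^ (2 * j) := Nat.pow_le_pow_right two_pos (by omega)
    omega
  have hx1R : (1 : ℝ) ≤ x := by exact_mod_cast hx1
  have hx0R : (0 : ℝ) < x := by linarith
  set h : ℕ := ⌈(x : ℝ) ^ (1 / 2 : ℝ)⌉₊ with hh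
  have hroot_pos : (0 : ℝ) < (x : ℝ) ^ (1 / 2 : ℝ) := Real.rpow_pos_of_pos hx0R _
  have hroot_le : (x : ℝ) ^ (1 / 2 : ℝ) ≤ x := by
    calc (x : ℝ) ^ (1 / 2 : ℝ) ≤ (x : ℝ) ^ (1 : ℝ) :=
          Real.rpow_le_rpow_of_exponent_le hx1R (by norm_num)
      _ = x := Real.rpow_one _
  have hh_ge : (x : ℝ) ^ (1 / 2 : ℝ) ≤ h := Nat.le_ceil _
  have hh_le : h ≤ x := by
    rw [hh]
    exact Nat.ceil_le.2 hroot_le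
  have hh1 : 1 ≤ h := by
    have : 0 < h := Nat.ceil_pos.2 hroot_pos
    omega
  -- the stub at this `x`, `h`
  have key := hN x hxN h hh_ge hh_le
  -- lower bound: the single term `n = 4^j`
  have hmem : 2 ^ (2 * j) ∈ Ioc x (x + h) := by
    rw [Finset.mem_Ioc]; omega
  have hlow : (19 / 10 : ℝ) ^ (2 * j) ≤ ∑ n ∈ Ioc x (x + h), (19 / 10 : ℝ) ^ OmegaF ![X] n := by
    have := Finset.single_le_sum (f := fun n : ℕ => (19 / 10 : ℝ) ^ OmegaF ![X] n)
      (fun _ _ => by positivity) hmem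
    simpa [omegaF_X_four_pow] using this
  -- upper bound for the right-hand side: `C h (log x)^{9/10} ≤ 6 |C| j 2^j`
  have hxle : (x : ℝ) ≤ (2 : ℝ) ^ (2 * j) := by
    have : x ≤ 2 ^ (2 * j) := Nat.sub_le _ _
    exact_mod_cast this
  have hroot_ub : (x : ℝ) ^ (1 / 2 : ℝ) ≤ (2 : ℝ) ^ j := by
    calc (x : ℝ) ^ (1 / 2 : ℝ) ≤ ((2 : ℝ) ^ (2 * j)) ^ (1 / 2 : ℝ) :=
          Real.rpow_le_rpow (by positivity) hxle (by norm_num)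
      _ = (2 : ℝ) ^ j := by
          rw [pow_mul, ← pow_right_comm] -- ((2^j)^2)^(1/2)
          rw [show ((2 : ℝ) ^ j) ^ 2 = ((2 : ℝ) ^ j) ^ (2 : ℕ) from rfl, one_div]
          exact Real.pow_rpow_inv_natCast (by positivity) two_ne_zero
  have hhR : (h : ℝ) ≤ (2 : ℝ) ^ j + 1 := by
    have := Nat.ceil_lt_add_one hroot_pos.le
    rw [← hh] at this
    linarith
  have hlog0 : 0 ≤ Real.log x := Real.log_nonneg hx1R
  have hlog_le : Real.log x ≤ 2 * j := by
    calc Real.log x ≤ Real.log ((2 : ℝ) ^ (2 * j)) := Real.log_le_log hx0R hxle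
      _ = (2 * j : ℕ) * Real.log 2 := by rw [Real.log_pow]
      _ ≤ (2 * j : ℕ) * 1 := by
          gcongr
          have := Real.log_two_lt_d9; linarith
      _ = 2 * j := by push_cast; ring
  have hL : (Real.log x) ^ (((1 : ℕ) : ℝ) * (19 / 10 - 1)) ≤ 2 * j + 1 := by
    have hexp : ((1 : ℕ) : ℝ) * (19 / 10 - 1) = (9 / 10 : ℝ) := by norm_num
    rw [hexp]
    rcases le_or_gt (Real.log x) 1 with hle | hlt
    · calc (Real.log x) ^ (9 / 10 : ℝ) ≤ 1 := Real.rpow_le_one hlog0 hle (by norm_num)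
        _ ≤ 2 * j + 1 := by
            have : (0 : ℝ) ≤ j := Nat.cast_nonneg j
            linarith
    · calc (Real.log x) ^ (9 / 10 : ℝ) ≤ (Real.log x) ^ (1 : ℝ) :=
            Real.rpow_le_rpow_of_exponent_le hlt.le (by norm_num)
        _ = Real.log x := Real.rpow_one _
        _ ≤ 2 * j + 1 := by linarith
  have hj1R : (1 : ℝ) ≤ j := by exact_mod_cast hj1
  have hrhs : C * h * (Real.log x) ^ (((1 : ℕ) : ℝ) * (19 / 10 - 1)) ≤ 6 * |C| * j * (2 : ℝ) ^ j := by
    have hL0 : 0 ≤ (Real.log x) ^ (((1 : ℕ) : ℝ) * (19 / 10 - 1)) := Real.rpow_nonneg hlog0 _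
    have hh0 : (0 : ℝ) ≤ h := Nat.cast_nonneg h
    calc C * h * (Real.log x) ^ (((1 : ℕ) : ℝ) * (19 / 10 - 1))
        ≤ |C| * h * (Real.log x) ^ (((1 : ℕ) : ℝ) * (19 / 10 - 1)) := by
          gcongr
          exact le_abs_self C
      _ ≤ |C| * ((2 : ℝ) ^ j + 1) * (2 * j + 1) := by gcongr
      _ ≤ |C| * (2 * (2 : ℝ) ^ j) * (3 * j) := by
          have h2j : (1 : ℝ) ≤ (2 : ℝ) ^ j := one_le_pow₀ (by norm_num)
          gcongr
          · linarith
          · linarith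
      _ = 6 * |C| * j * (2 : ℝ) ^ j := by ring
  -- contradiction
  have := calc (19 / 10 : ℝ) ^ (2 * j) ≤ _ := hlow
    _ ≤ _ := key
    _ ≤ 6 * |C| * j * (2 : ℝ) ^ j := hrhs
  exact absurd hjC (not_lt.2 this)

end

end Summit.Parity.BatemanHorn.Cruxes.LSDRealSegment.TriageR1K1
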